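import Literature.Barriers.ValiantsHypothesis.BIJL18MatrixCompletion
import Mathlib.LinearAlgebra.Matrix.SchurComplement
import Mathlib.LinearAlgebra.Matrix.Block
import HarnessLib

/-!
# Bläser–Ikenmeyer–Jindal–Lysikov 2018, §5 — the rank core of the `T_φ` analysis

Abstract linear algebra behind the safe reading of Lemma 22(2) [BlaserIkenmeyerJindalLysikov2018,
§5, ECCC TR18-064 pp.16–17]: a matrix `M` on `Fin s × Fin 9` whose local-variable rows
`(j, varCol a)` (printed rows `2, 4, 6` of gadget `j`) and clause rows `(j, clauseRow a)` (printed
rows `7, 8, 9`) have the shape of the `9 × 9` clause gadget of §5 — whatever the coupling entries in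
the variable rows `(j, varRow a)` (printed rows `1, 3, 5`) are — satisfies:
* `rk M ≥ 5s` ("From every clause gadget, the local columns `1, 3, 5, 8`, and `9` are linearly
  independent … there are only nonzero entries outside the gadget in the local columns `2, 4`, and
  `6` and rows `1, 3`, and `5`", ECCC p.16): the minor on rows `(2,4,6,8,7)` × columns
  `(1,3,5,9,8)` of every gadget is unitriangular;
* if `rk M ≤ 5s` then these `5s` columns span, and reading the local columns `2, 4, 6` and the
  clause column `7` of each gadget in that basis gives `u = x`, `v = y`, `w = z` and
  `(1−ℓ(u))(1−ℓ(v))(1−ℓ(w)) = 0` (the four determinants of the printed proof of Lemma 21(2),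
  ECCC pp.15–16, obtained here without assuming the couplings vanish).
* `tphiCore_of_local_span`: the same conclusion for ONE block `j` from the local hypothesis that
  the block-`j` segment of every column lies in the span of the block-`j` segments of the five
  selected columns of block `j` (the block-by-block form used by the bounded-occurrence repair of
  Lemma 22 (2), val-lit p2).
Theorem-only file; hypotheses are explicit row-shape assumptions, instantiated for `T_φ` in the
sibling file `BIJL18TPhiSafeProofs.lean`. HONEST FRAMING: typed literature; `VP ≠ VNP` is NOT proved.
-/

noncomputable section

namespace Literature.Barriers.ValiantsHypothesis

open Literature.Computability.AlgebraicComplexity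

universe u

variable {K : Type u} [Field K]

/-! ### Factorisation through an invertible rectangular block -/

/-- If `rk B ≤ |κ|` and the block `P = B[r,c]` on rows `r`, columns `c` is invertible then
`B = B[·,c] · P⁻¹ · B[r,·]` (Schur complement on the `(|κ|+1)`-minors through `P`). [folklore] -/
private theorem eq_mul_inv_mul_of_rank_le {ι κ : Type*} [Fintype ι] [Fintype κ] [DecidableEq ι]
    [DecidableEq κ] (B : Matrix ι ι K) (r c : κ → ι) (hP : IsUnit (B.submatrix r c).det)
    (hr : B.rank ≤ Fintype.card κ) :
    B = B.submatrix id c * (B.submatrix r c)⁻¹ * B.submatrix r id := by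
  set P : Matrix κ κ K := B.submatrix r c with hPdef
  ext i q
  letI : Invertible P := ((Matrix.isUnit_iff_isUnit_det P).2 hP).invertible
  have hblock : B.submatrix (Sum.elim r (fun _ : Unit => i)) (Sum.elim c (fun _ : Unit => q)) =
      Matrix.fromBlocks P (Matrix.of fun k _ => B (r k) q) (Matrix.of fun _ k => B i (c k))
        (Matrix.of fun _ _ => B i q) := by
    ext (k | x) (k' | x') <;> rfl
  have hdet0 : (B.submatrix (Sum.elim r (fun _ : Unit => i)) (Sum.elim c (fun _ : Unit => q))).det = 0 :=
    Literature.LinearAlgebra.Matrix.det_submatrix_eq_zero_of_rank_lt_card B _ _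
      (by rw [Fintype.card_sum, Fintype.card_unit]; omega)
  rw [hblock, Matrix.det_fromBlocks₁₁, Matrix.invOf_eq_nonsing_inv] at hdet0
  have hentry := (mul_eq_zero.1 hdet0).resolve_left hP.ne_zero
  rw [Matrix.det_unique] at hentry
  simp only [Matrix.sub_apply, Matrix.of_apply, sub_eq_zero] at hentry
  rw [hentry]
  simp only [Matrix.mul_apply, Matrix.submatrix_apply, id_eq, Matrix.of_apply, hPdef]

/-! ### The `5s` independent columns -/

section Core

variable {s : ℕ} (M : Matrix (Fin s × Fin 9) (Fin s × Fin 9) K) (x uu d e g : Fin s → Fin 3 → K)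

/-- **`rk ≥ 5s`** for a matrix with gadget-shaped local-variable rows and clause rows: the minor on
the rows `(varCol 0, varCol 1, varCol 2, clauseRow 1, clauseRow 0)` and columns
`(varRow 0, varRow 1, varRow 2, clauseRow 2, clauseRow 1)` of every block is unitriangular, and
the whole minor is block diagonal ("the local columns `1, 3, 5, 8`, and `9` are linearly
independent, even if we remove the local rows `1, 3`, and `5`").
[cite: BlaserIkenmeyerJindalLysikov2018, Lemma 22 (proof)] locator: ECCC p.16 -/
theorem tphiCore_five_mul_le_rank
    (H2 : ∀ j a q, M (j, varCol a) q = (if q = (j, varRow a) then 1 else 0) +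
      (if q = (j, varCol a) then uu j a else 0) + (if q = (j, clauseRow a) then d j a else 0))
    (H30 : ∀ j q, M (j, clauseRow 0) q = (if q = (j, varCol 0) then e j 0 else 0) +
      (if q = (j, clauseRow 0) then g j 0 else 0) + (if q = (j, clauseRow 1) then 1 else 0))
    (H31 : ∀ j q, M (j, clauseRow 1) q = (if q = (j, varCol 1) then e j 1 else 0) +
      (if q = (j, clauseRow 1) then g j 1 else 0) + (if q = (j, clauseRow 2) then 1 else 0)) :
    (M.submatrix (fun p : Fin 5 × Fin s => (p.2, (![varCol 0, varCol 1, varCol 2, clauseRow 1,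
        clauseRow 0] : Fin 5 → Fin 9) p.1))
      (fun p : Fin 5 × Fin s => (p.2, (![varRow 0, varRow 1, varRow 2, clauseRow 2,
        clauseRow 1] : Fin 5 → Fin 9) p.1))).det = 1 ∧ 5 * s ≤ M.rank := by
  -- entries of the selected submatrix, block by block
  have hblock : ∀ (j j' : Fin s) (i i' : Fin 5),
      M (j, (![varCol 0, varCol 1, varCol 2, clauseRow 1, clauseRow 0] : Fin 5 → Fin 9) i)
        (j', (![varRow 0, varRow 1, varRow 2, clauseRow 2, clauseRow 1] : Fin 5 → Fin 9) i') =
      if j = j' then (!![1, 0, 0, 0, 0; 0, 1, 0, 0, d j 1; 0, 0, 1, d j 2, 0; 0, 0, 0, 1, g j 1;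
        0, 0, 0, 0, 1] : Matrix (Fin 5) (Fin 5) K) i i' else 0 := by
    intro j j' i i'
    by_cases hj : j = j'
    · subst hj
      fin_cases i <;> fin_cases i' <;> simp +decide [H2, H30, H31]
    · have hj' : j' ≠ j := fun h => hj h.symm
      fin_cases i <;> fin_cases i' <;> simp +decide [H2, H30, H31, hj, hj']
  have hS : M.submatrix (fun p : Fin 5 × Fin s => (p.2, (![varCol 0, varCol 1, varCol 2, clauseRow 1,
        clauseRow 0] : Fin 5 → Fin 9) p.1))
      (fun p : Fin 5 × Fin s => (p.2, (![varRow 0, varRow 1, varRow 2, clauseRow 2,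
        clauseRow 1] : Fin 5 → Fin 9) p.1)) =
      Matrix.blockDiagonal fun j : Fin s => (!![1, 0, 0, 0, 0; 0, 1, 0, 0, d j 1; 0, 0, 1, d j 2, 0;
        0, 0, 0, 1, g j 1; 0, 0, 0, 0, 1] : Matrix (Fin 5) (Fin 5) K) := by
    ext ⟨i, j⟩ ⟨i', j'⟩
    rw [Matrix.submatrix_apply, Matrix.blockDiagonal_apply, hblock]
  have hdetT : ∀ j : Fin s, (!![1, 0, 0, 0, 0; 0, 1, 0, 0, d j 1; 0, 0, 1, d j 2, 0;
      0, 0, 0, 1, g j 1; 0, 0, 0, 0, 1] : Matrix (Fin 5) (Fin 5) K).det = 1 := by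
    intro j
    rw [Matrix.det_of_upperTriangular]
    · simp [Fin.prod_univ_five]
    · intro i i' hii'
      fin_cases i <;> fin_cases i' <;> simp at hii' ⊢
  have hdet : (M.submatrix (fun p : Fin 5 × Fin s => (p.2, (![varCol 0, varCol 1, varCol 2,
        clauseRow 1, clauseRow 0] : Fin 5 → Fin 9) p.1))
      (fun p : Fin 5 × Fin s => (p.2, (![varRow 0, varRow 1, varRow 2, clauseRow 2,
        clauseRow 1] : Fin 5 → Fin 9) p.1))).det = 1 := by
    rw [hS, Matrix.det_blockDiagonal]
    simp [hdetT]
  refine ⟨hdet, ?_⟩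
  have h := Literature.LinearAlgebra.Matrix.card_le_rank_of_det_submatrix_ne_zero M _ _
    (by rw [hdet]; exact one_ne_zero)
  simpa [Fintype.card_prod, mul_comm] using h

/-- Every local index is a variable row, a local-variable row or a clause row. [folklore] -/
private theorem fin9_trichotomy (i : Fin 9) :
    (∃ a : Fin 3, i = varRow a) ∨ (∃ a : Fin 3, i = varCol a) ∨ (∃ a : Fin 3, i = clauseRow a) := by
  revert i; decide

/-- **Local form of the consequences** (the step the bounded-occurrence repair of Lemma 22 (2)
uses block by block, val-lit p2): if the block-`j` segment of EVERY column of `M` lies in the span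
of the block-`j` segments of block `j`'s five selected columns `(varRow 0, varRow 1, varRow 2,
clauseRow 2, clauseRow 1)` — with coefficients `α` — then reading the local columns `2, 4, 6` and
the first clause column `7` of block `j` gives `u = x`, `v = y`, `w = z` and
`(1−ℓ(u))(1−ℓ(v))(1−ℓ(w)) = 0`, whatever the coupling entries in the variable rows are.
[cite: BlaserIkenmeyerJindalLysikov2018, Lemma 21 (2) and Lemma 22 (proof)] locator: ECCC pp.15–17 -/
theorem tphiCore_of_local_span
    (H1r : ∀ j a j' b, M (j, varRow a) (j', varRow b) = if (j', varRow b) = (j, varRow a) then 1 else 0)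
    (H1c : ∀ j a j' b, M (j, varRow a) (j', clauseRow b) = 0)
    (H1' : ∀ j a, M (j, varRow a) (j, varCol a) = x j a)
    (H2 : ∀ j a q, M (j, varCol a) q = (if q = (j, varRow a) then 1 else 0) +
      (if q = (j, varCol a) then uu j a else 0) + (if q = (j, clauseRow a) then d j a else 0))
    (H30 : ∀ j q, M (j, clauseRow 0) q = (if q = (j, varCol 0) then e j 0 else 0) +
      (if q = (j, clauseRow 0) then g j 0 else 0) + (if q = (j, clauseRow 1) then 1 else 0))
    (H31 : ∀ j q, M (j, clauseRow 1) q = (if q = (j, varCol 1) then e j 1 else 0) +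
      (if q = (j, clauseRow 1) then g j 1 else 0) + (if q = (j, clauseRow 2) then 1 else 0))
    (H32 : ∀ j q, M (j, clauseRow 2) q = (if q = (j, varCol 2) then e j 2 else 0) +
      (if q = (j, clauseRow 2) then g j 2 else 0))
    (j : Fin s) (α : Fin 5 → Fin s × Fin 9 → K)
    (hspan : ∀ (i₉ : Fin 9) (q : Fin s × Fin 9), M (j, i₉) q =
      M (j, i₉) (j, varRow 0) * α 0 q + M (j, i₉) (j, varRow 1) * α 1 q +
        M (j, i₉) (j, varRow 2) * α 2 q + M (j, i₉) (j, clauseRow 2) * α 3 q +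
        M (j, i₉) (j, clauseRow 1) * α 4 q) :
    (∀ a, uu j a = x j a) ∧ g j 0 * g j 1 * g j 2 = 0 := by
  -- the rows of block `j`, read through `hspan`
  have rVR : ∀ (a : Fin 3) q, M (j, varRow a) q =
      (if a = 0 then α 0 q else 0) + (if a = 1 then α 1 q else 0) +
        (if a = 2 then α 2 q else 0) := by
    intro a q; rw [hspan]; fin_cases a <;> simp +decide [H1r, H1c]
  have rVC : ∀ (a : Fin 3) q, M (j, varCol a) q =
      (if a = 0 then α 0 q else 0) + (if a = 1 then α 1 q + d j 1 * α 4 q else 0) +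
        (if a = 2 then α 2 q + d j 2 * α 3 q else 0) := by
    intro a q; rw [hspan]; fin_cases a <;> simp +decide [H2]
  have rC0 : ∀ q, M (j, clauseRow 0) q = α 4 q := by
    intro q; rw [hspan]; simp +decide [H30]
  have rC1 : ∀ q, M (j, clauseRow 1) q = α 3 q + g j 1 * α 4 q := by
    intro q; rw [hspan]; simp +decide [H31]
  have rC2 : ∀ q, M (j, clauseRow 2) q = g j 2 * α 3 q := by
    intro q; rw [hspan]; simp +decide [H32]
  have fin3 : ∀ a : Fin 3, a = 0 ∨ a = 1 ∨ a = 2 := by decide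
  refine ⟨fun a => ?_, ?_⟩
  · -- `u = x`, `v = y`, `w = z`: read the column `(j, varCol a)`
    have ha := rVR a (j, varCol a)
    rw [H1'] at ha
    have hb := rVC a (j, varCol a)
    rw [H2] at hb
    have hc := rC0 (j, varCol a)
    rw [H30] at hc
    have hd := rC1 (j, varCol a)
    rw [H31] at hd
    rcases fin3 a with rfl | rfl | rfl
    · simp +decide at ha hb
      rw [hb, ha]
    · simp +decide at ha hb hc
      rw [hb, ha, ← hc]; ring
    · simp +decide at ha hb hc hd
      rw [← hc] at hd
      rw [hb, ha]
      have h3 : α 3 (j, varCol 2) = 0 := by linear_combination -hd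
      rw [h3]; ring
  · -- `(1−ℓ(u))(1−ℓ(v))(1−ℓ(w)) = 0`: read the column `(j, clauseRow 0)`
    have h0 := rC0 (j, clauseRow 0)
    rw [H30] at h0
    have h1 := rC1 (j, clauseRow 0)
    rw [H31] at h1
    have h2 := rC2 (j, clauseRow 0)
    rw [H32] at h2
    simp +decide only [Prod.mk.injEq, true_and, if_true, if_false, zero_add, add_zero]
      at h0 h1 h2
    linear_combination (g j 1 * g j 2) * h0 - (g j 2) * h1 + h2

/-- **Consequences of `rk ≤ 5s`**: the `5s` columns then span the column space; expressing the
local columns `2, 4, 6` and the first clause column `7` of each block in them gives `u = x`,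
`v = y`, `w = z` and `(1−ℓ(u))(1−ℓ(v))(1−ℓ(w)) = 0` — the content of the four determinants of
Lemma 21(2), here valid in the presence of arbitrary coupling entries in the variable rows.
[cite: BlaserIkenmeyerJindalLysikov2018, Lemma 21 (2) and Lemma 22 (proof)] locator: ECCC pp.15–17 -/
theorem tphiCore_of_rank_le
    (H1r : ∀ j a j' b, M (j, varRow a) (j', varRow b) = if (j', varRow b) = (j, varRow a) then 1 else 0)
    (H1c : ∀ j a j' b, M (j, varRow a) (j', clauseRow b) = 0)
    (H1' : ∀ j a, M (j, varRow a) (j, varCol a) = x j a)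
    (H2 : ∀ j a q, M (j, varCol a) q = (if q = (j, varRow a) then 1 else 0) +
      (if q = (j, varCol a) then uu j a else 0) + (if q = (j, clauseRow a) then d j a else 0))
    (H30 : ∀ j q, M (j, clauseRow 0) q = (if q = (j, varCol 0) then e j 0 else 0) +
      (if q = (j, clauseRow 0) then g j 0 else 0) + (if q = (j, clauseRow 1) then 1 else 0))
    (H31 : ∀ j q, M (j, clauseRow 1) q = (if q = (j, varCol 1) then e j 1 else 0) +
      (if q = (j, clauseRow 1) then g j 1 else 0) + (if q = (j, clauseRow 2) then 1 else 0))
    (H32 : ∀ j q, M (j, clauseRow 2) q = (if q = (j, varCol 2) then e j 2 else 0) +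
      (if q = (j, clauseRow 2) then g j 2 else 0))
    (hr : M.rank ≤ 5 * s) (j : Fin s) :
    (∀ a, uu j a = x j a) ∧ g j 0 * g j 1 * g j 2 = 0 := by
  classical
  -- the factorisation through the invertible `5s × 5s` block
  set rfun : Fin 5 × Fin s → Fin s × Fin 9 := fun p =>
    (p.2, (![varCol 0, varCol 1, varCol 2, clauseRow 1, clauseRow 0] : Fin 5 → Fin 9) p.1) with hrfun
  set cfun : Fin 5 × Fin s → Fin s × Fin 9 := fun p =>
    (p.2, (![varRow 0, varRow 1, varRow 2, clauseRow 2, clauseRow 1] : Fin 5 → Fin 9) p.1) with hcfun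
  obtain ⟨hdet, -⟩ := tphiCore_five_mul_le_rank M uu d e g H2 H30 H31
  have hunit : IsUnit (M.submatrix rfun cfun).det := by rw [hdet]; exact isUnit_one
  have hfac := eq_mul_inv_mul_of_rank_le M rfun cfun hunit
    (by simpa [Fintype.card_prod, mul_comm] using hr)
  set α : Matrix (Fin 5 × Fin s) (Fin s × Fin 9) K :=
    (M.submatrix rfun cfun)⁻¹ * M.submatrix rfun id with hα
  have key : ∀ i q, M i q = ∑ k : Fin 5 × Fin s, M i (cfun k) * α k q := by
    intro i q
    conv_lhs => rw [hfac, Matrix.mul_assoc]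
    rw [Matrix.mul_apply]
    rfl
  -- cross-block entries of the selected columns vanish
  have hcross : ∀ (j j' : Fin s) (i₉ : Fin 9) (i : Fin 5), j' ≠ j →
      M (j, i₉) (j', (![varRow 0, varRow 1, varRow 2, clauseRow 2, clauseRow 1] :
        Fin 5 → Fin 9) i) = 0 := by
    intro j j' i₉ i hj
    have hj' : j ≠ j' := fun h => hj h.symm
    rcases fin9_trichotomy i₉ with ⟨a, rfl⟩ | ⟨a, rfl⟩ | ⟨a, rfl⟩
    · fin_cases i <;> simp [H1r, H1c, hj]
    · fin_cases i <;> simp [H2, hj]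
    · fin_cases a <;> fin_cases i <;> simp [H30, H31, H32, hj]
  -- hence the sums in `key` collapse to the five columns of the own block: the local span form
  refine tphiCore_of_local_span M x uu d e g H1r H1c H1' H2 H30 H31 H32 j (fun i q => α (i, j) q)
    fun i₉ q => ?_
  rw [key, Fintype.sum_prod_type, Fin.sum_univ_five]
  have hin : ∀ i : Fin 5, ∑ j' : Fin s, M (j, i₉) (cfun (i, j')) * α (i, j') q =
      M (j, i₉) (cfun (i, j)) * α (i, j) q := by
    intro i
    rw [Finset.sum_eq_single j]
    · intro j' _ hj'
      rw [show cfun (i, j') = (j', (![varRow 0, varRow 1, varRow 2, clauseRow 2, clauseRow 1] :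
        Fin 5 → Fin 9) i) from rfl, hcross j j' i₉ i hj', zero_mul]
    · intro h; exact absurd (Finset.mem_univ j) h
  simp only [hin]
  rfl

end Core

end Literature.Barriers.ValiantsHypothesis

end
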